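import Literature.Geometry.Lorentzian.ChartCalculus
import HarnessLib

/-!
# The Christoffel map from a compatible expression of the metric derivative

Topic `Geometry/Riemannian` (chart calculus in the `OpensChart` setting of
`Literature.Geometry.Lorentzian.ChartCalculus`). If at a point `x` of `U : Opens E` the
derivative of the metric components is of the "compatible" form
`∂_z G(u, w) = g(B(z, u), w) + g(u, B(z, w))` for a symmetric map `B : E → E → E`, then the
Christoffel map at `x` is `B`: `Γ_x(Y)(X) = B(X, Y)` (`christoffel_eq_of_fderiv_eq`). Indeed the
Koszul form collapses, `K(Y, X, Z) = 2 g(B(X, Y), Z)`, by the symmetries of `g` and `B`, and `g` is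
nondegenerate (O'Neill 1983, Ch. 3, Prop. 13 and its proof: the Christoffel symbols are determined
by `2 g(Γ(X, Y), Z) = K(X, Y, Z)`).

This is how the Christoffel symbols of the tube metric around Weinstein's arc are read off on the
axis (Weinstein 1968, proof of the main theorem, step (2)): there `∂_z G(u, w)` is given by metric
compatibility along the coordinate lines (`CurveTubeSecondOrder.hasDerivAt_val_mfderiv_tubeMap`)
with `B(z, u) = e⁻¹ D_z(dΦ u)`, symmetric by the symmetry lemma.

## References

* B. O'Neill, *Semi-Riemannian Geometry*, Academic Press (1983), Ch. 3, Prop. 13.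
  [cite: ONeill1983, Ch. 3, Prop. 3.13]
* A. Weinstein, Ann. of Math. (2) 87 (1968), 29–41. [cite: Weinstein1968]

Tags: [ChartCalculus] [ChristoffelSymbols] [Weinstein1968]
-/

noncomputable section

open Bundle Set Function TopologicalSpace
open scoped Manifold ContDiff Topology

namespace Literature.Geometry.Riemannian

open Literature.Geometry.Lorentzian
open Literature.Geometry.Lorentzian.OpensChart
open Literature.Geometry.Lorentzian.PseudoRiemannianMetric

variable {E : Type*} [NormedAddCommGroup E] [NormedSpace ℝ E] [FiniteDimensional ℝ E]
  {U : Opens E} {n : ℕ∞ω}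
  {g : PseudoRiemannianMetric 𝓘(ℝ, E) n E (TangentSpace 𝓘(ℝ, E) : U → Type _)}
  {G : E → E →L[ℝ] E →L[ℝ] ℝ}

omit [FiniteDimensional ℝ E] in
/-- **The Koszul form of a compatible derivative collapses**: if
`∂_z G(u, w) = g(B(z, u), w) + g(u, B(z, w))` at `x` with `B` symmetric, then
`K_x(Y, X, Z) = 2 g(B(X, Y), Z)`. [cite: ONeill1983, Ch. 3, Prop. 3.13] -/
theorem koszulForm_eq_of_fderiv_eq (x : U) {B : E → E → E} (hB : ∀ a b, B a b = B b a)
    (hD : ∀ z u w : E, fderiv ℝ G x z u w = g.val x (B z u) w + g.val x u (B z w))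
    (Y X Z : E) :
    koszulForm G x Y X Z = 2 * g.val x (B X Y) Z := by
  rw [koszulForm_apply, hD, hD, hD]
  have s1 : g.val x Y (B X Z) = g.val x (B Z X) Y := by rw [g.symm x, hB]
  have s2 : g.val x (B Y Z) X = g.val x X (B Z Y) := by rw [g.symm x, hB]
  have s3 : g.val x Z (B Y X) = g.val x (B X Y) Z := by rw [g.symm x, hB]
  rw [s1, s2, s3]
  ring

/-- **The Christoffel map from a compatible expression of the metric derivative**: if
`∂_z G(u, w) = g(B(z, u), w) + g(u, B(z, w))` at `x` for a symmetric `B : E → E → E`, then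
`Γ_x(Y)(X) = B(X, Y)` — from `2 g(Γ_x(Y)(X), Z) = K_x(Y, X, Z) = 2 g(B(X, Y), Z)`
(`two_mul_val_christoffel`, `koszulForm_eq_of_fderiv_eq`) and the nondegeneracy of `g`.
[cite: ONeill1983, Ch. 3, Prop. 3.13] -/
theorem christoffel_eq_of_fderiv_eq (x : U) {B : E → E → E} (hB : ∀ a b, B a b = B b a)
    (hD : ∀ z u w : E, fderiv ℝ G x z u w = g.val x (B z u) w + g.val x u (B z w))
    (Y X : E) :
    christoffel g G x Y X = B X Y := by
  have h : ∀ Z : E, g.val x (christoffel g G x Y X - B X Y) Z = 0 := by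
    intro Z
    have h2 := two_mul_val_christoffel (g := g) (G := G) x Y X Z
    rw [koszulForm_eq_of_fderiv_eq x hB hD] at h2
    have e : g.val x (christoffel g G x Y X - B X Y) Z =
        g.val x (christoffel g G x Y X) Z - g.val x (B X Y) Z :=
      (g.val x).map_sub₂ _ _ _
    rw [e]
    linarith
  have h0 := g.nondegenerate x (christoffel g G x Y X - B X Y) h
  exact sub_eq_zero.1 h0

end Literature.Geometry.Riemannian

end
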